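import Literature.IUT.HodgeArakelov.LabelClassesOfCusps
import Literature.IUT.HodgeTheaters.PMBaseKit
import HarnessLib

/-!
# Bridge (MERGE-MAP row 99): `LabCusp^±(Π_v)` of [IUTchII] Def 2.3 (iii) over the `𝔽_l^±`-group `LabCusp^±(†𝒟_v)` of [IUTchI] Def 6.1 (iii)

Mochizuki, *Inter-universal Teichmüller Theory II*, kurims manuscript (Dec. 2020), §2, Def 2.3 (iii) p.68;
*Inter-universal Teichmüller Theory I*, kurims manuscript (May 2020), §6, Def 6.1 (i) p.155, (iii) pp.156–157
[cite: Mochizuki2012, II Def 2.3 (iii) p.68, I Def 6.1 (i) p.155, I Def 6.1 (iii) pp.156–157]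
(D-0012 claim key, status disputed; a BRIDGE between two landed typings — nothing of the series is asserted).

[IUTchII] Def 2.3 (iii) p.68: "`LabCusp^±(Π_v) = LabCusp^±(†𝒟_v)` admits a natural action by `𝔽_l^×`, as well as a zero
element `†η^0_v` and a `±`-canonical element `†η^±_v` — well-defined up to multiplication by `±1`, which may be constructed
solely from `†𝒟_v` [cf. [IUTchI], Definition 6.1, (iii)]".  abc-iut-L6-t1 typed this as the INTERFACE
`LabCuspStructure C` over its group-theoretic `LabCuspPM C W.piV W.piPM` (an `𝔽_l^×`-action `act`, `eta0`, `etaPM`, one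
bijection `toFl : LabCusp^±(Π_v) ≃ 𝔽_l` with `toFl eta0 = 0`, `toFl etaPM = ±1`, `toFl (act a t) = a · toFl t`);
abc-iut-L5-t4's kit types [IUTchI] Def 6.1 (iii) as `K.labPM v X hX : FlPMGroup l (K.LabCuspPM v X)` — a `{±1}`-ORBIT of
charts `LabCusp^±(†𝒟_v) ≃ 𝔽_l` ([IUTchI] Def 6.1 (i): "any set `E` equipped with a `{±1}`-orbit of bijections `E ⥲ 𝔽_l`").
This file records the identification as an explicit AGREEMENT (`LabCuspStructure.KitAgreement`: a bijection `e` under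
which abc-iut-L6-t1's `toFl` is ONE OF the kit's charts) and PROVES what it buys: every kit chart reads abc-iut-L6-t1's
labels as `± toFl` (`chart_apply_eq_or`), sends `†η^0_v` to `0` (`chart_eta0`), `†η^±_v` to `±1` (`chart_etaPM`), and is
`𝔽_l^×`-equivariant (`chart_act`) — i.e. the `𝔽_l^×`-action, the zero element and the `±`-canonical element of
[IUTchII] Def 2.3 (iii) ARE the ones determined by the `𝔽_l^±`-group structure of [IUTchI] Def 6.1 (iii), whichever chart
of the `{±1}`-orbit is used.
-/

namespace Literature.IUT.HodgeArakelov

open Literature.IUT.HodgeTheaters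
open CategoryTheory

universe u

variable {S : BadPlaceSetting.{u}} {P : TopGroup.{u}} {T : TemperedCoverings S P} {W : PlusMinusTower T}
  {C : CuspidalInertiaData W}

namespace LabCuspStructure

/-- **IUTchII:Def2.3(iii)** (kurims p.68) AGREEMENT «`LabCusp^±(Π_v) = LabCusp^±(†𝒟_v)`» between abc-iut-L6-t1's interface `L : LabCuspStructure C`
and abc-iut-L5-t4's `𝔽_l^±`-group `K.labPM v X hX` ([IUTchI] Def 6.1 (iii)) at the isomorph `X = †𝒟_v` of `𝒟_v`
("`†𝒟_v := ℬ^temp(Π_v)⁰`"): a bijection of label sets under which abc-iut-L6-t1's `toFl` is one of the kit's charts.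
A hypothesis structure (the common model instantiates it); nothing asserted. [claim: Mochizuki2012, status: disputed] -/
structure KitAgreement (L : LabCuspStructure C) (K : PMBaseKit.{u} S.l) (v : K.V) (X : K.Amb v)
    (hX : Nonempty (X ≅ K.model v)) where
  /-- `LabCusp^±(Π_v) ⥲ LabCusp^±(†𝒟_v)` -/
  e : LabCuspPM C W.piV W.piPM ≃ K.LabCuspPM v X
  /-- abc-iut-L6-t1's identification with `𝔽_l` is one of the `{±1}`-orbit of charts of [IUTchI] Def 6.1 (iii) -/
  chart_mem : e.symm.trans L.toFl ∈ (K.labPM v X hX).charts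

namespace KitAgreement

variable {L : LabCuspStructure C} {K : PMBaseKit.{u} S.l} {v : K.V} {X : K.Amb v}
  {hX : Nonempty (X ≅ K.model v)} (A : L.KitAgreement K v X hX)

/-- **IUTchI:Def6.1(i)** (kurims p.155) Every chart of the kit's `𝔽_l^±`-group structure is `± toFl` on abc-iut-L6-t1's labels: there is `ε ∈ {±1}` with
`e' (e t) = ε · toFl t` for all `t`. PROVED from `FlPMGroup.eq_orbit`. [claim: Mochizuki2012, status: disputed] -/
theorem exists_sign (A : L.KitAgreement K v X hX) {e' : K.LabCuspPM v X ≃ ZMod S.l}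
    (he' : e' ∈ (K.labPM v X hX).charts) : ∃ ε : ℤˣ, ∀ t, e' (A.e t) = ε • L.toFl t := by
  have h := (K.labPM v X hX).eq_orbit _ A.chart_mem
  rw [h] at he'
  obtain ⟨ε, rfl⟩ := he'
  exact ⟨ε, fun t => by simp⟩

/-- **IUTchI:Def6.1(i)** (kurims p.155) … hence `e' (e t) = toFl t` for all `t`, or `e' (e t) = − toFl t` for all `t`. PROVED.
[claim: Mochizuki2012, status: disputed] -/
theorem chart_apply_eq_or (A : L.KitAgreement K v X hX) {e' : K.LabCuspPM v X ≃ ZMod S.l}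
    (he' : e' ∈ (K.labPM v X hX).charts) :
    (∀ t, e' (A.e t) = L.toFl t) ∨ (∀ t, e' (A.e t) = -L.toFl t) := by
  obtain ⟨ε, hε⟩ := A.exists_sign he'
  rcases Int.units_eq_one_or ε with rfl | rfl
  · exact Or.inl fun t => by rw [hε t, one_smul]
  · exact Or.inr fun t => by rw [hε t, Units.smul_def, Units.val_neg, Units.val_one, neg_one_zsmul]

/-- **IUTchII:Def2.3(iii)** (kurims p.68) The zero element `†η^0_v` of [IUTchII] Def 2.3 (iii) IS the zero of the `𝔽_l^±`-group structure of [IUTchI] Def 6.1 (iii):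
every kit chart sends it to `0`. PROVED. [claim: Mochizuki2012, status: disputed] -/
theorem chart_eta0 (A : L.KitAgreement K v X hX) {e' : K.LabCuspPM v X ≃ ZMod S.l}
    (he' : e' ∈ (K.labPM v X hX).charts) : e' (A.e L.eta0) = 0 := by
  obtain ⟨ε, hε⟩ := A.exists_sign he'
  rw [hε, L.toFl_eta0, smul_zero]

/-- **IUTchII:Def2.3(iii)** (kurims p.68) The `±`-canonical element `†η^±_v` ("well-defined up to multiplication by `±1`") goes to `±1` under every kit
chart. PROVED. [claim: Mochizuki2012, status: disputed] -/
theorem chart_etaPM (A : L.KitAgreement K v X hX) {e' : K.LabCuspPM v X ≃ ZMod S.l}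
    (he' : e' ∈ (K.labPM v X hX).charts) : e' (A.e L.etaPM) = 1 ∨ e' (A.e L.etaPM) = -1 := by
  rcases A.chart_apply_eq_or he' with h | h <;> rw [h] <;> rcases L.toFl_etaPM with h1 | h1 <;> rw [h1]
  · exact Or.inl rfl
  · exact Or.inr rfl
  · exact Or.inr rfl
  · left; rw [neg_neg]

/-- **IUTchII:Def2.3(iii)** (kurims p.68) The "natural action by `𝔽_l^×`" of [IUTchII] Def 2.3 (iii) is multiplication in ANY chart of the kit's
`𝔽_l^±`-group structure (the `{±1}`-ambiguity commutes with `𝔽_l^×`). PROVED. [claim: Mochizuki2012, status: disputed] -/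
theorem chart_act (A : L.KitAgreement K v X hX) {e' : K.LabCuspPM v X ≃ ZMod S.l}
    (he' : e' ∈ (K.labPM v X hX).charts) (a : (ZMod S.l)ˣ) (t : LabCuspPM C W.piV W.piPM) :
    e' (A.e (L.act a t)) = (a : ZMod S.l) * e' (A.e t) := by
  obtain ⟨ε, hε⟩ := A.exists_sign he'
  rw [hε, hε, L.toFl_act, Units.smul_def, Units.smul_def, zsmul_eq_mul, zsmul_eq_mul]
  ring

/-- **IUTchII:Def2.3(iii)** (kurims p.68) Transport of the agreement along an isomorphism `†𝒟_v ⥲ ‡𝒟_v` of isomorphs of `𝒟_v` ("may be constructed solely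
from `†𝒟_v`": functoriality `K.labMap`, whose charts pull back to charts, `K.labMap_charts`). [claim: Mochizuki2012, status: disputed] -/
def map (A : L.KitAgreement K v X hX) {Y : K.Amb v} (hY : Nonempty (Y ≅ K.model v)) (φ : X ≅ Y) :
    L.KitAgreement K v Y hY where
  e := A.e.trans (K.labMap v φ)
  chart_mem := by
    -- pull a chart of `Y` back along `φ`; abc-iut-L6-t1's chart is in the orbit of the pulled-back chart
    obtain ⟨eY, heY⟩ := (K.labPM v Y hY).nonempty
    have hpull : (K.labMap v φ).trans eY ∈ (K.labPM v X hX).charts := K.labMap_charts v hX hY φ eY heY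
    -- `toFl ∘ e⁻¹ = (pulled-back chart) ∘ (± 1)` on `X`; rewrite membership for `Y` through `eq_orbit`
    have hX' := (K.labPM v X hX).eq_orbit _ hpull
    have hmem := A.chart_mem
    rw [hX'] at hmem
    obtain ⟨ε, hε⟩ := hmem
    rw [(K.labPM v Y hY).eq_orbit _ heY]
    refine ⟨ε, ?_⟩
    ext t
    have := congrArg (fun f : K.LabCuspPM v X ≃ ZMod S.l => f ((K.labMap v φ).symm t)) hε
    simpa using this

end KitAgreement

end LabCuspStructure

end Literature.IUT.HodgeArakelov
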